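import Literature.AnabelianGeometry.AbsoluteAnabelian.ArchimedeanReconstructionCor29Sub
import Literature.AnabelianGeometry.AbsoluteAnabelian.HolomorphicCoresLocalLinearProofs
import Mathlib.Analysis.Calculus.Deriv.Slope
import Mathlib.Analysis.SpecificLimits.Basic
import HarnessLib

/-!
# [AbsTopIII] Corollary 2.9 — the planar MODEL of the printed constructions, proved

S. Mochizuki, *Topics in absolute anabelian geometry III*, Corollary 2.9 (kurims pp.64–65, bib key
`MochizukiAbsTopIII2015`; sub-DAG `plan/L4/SUBDAG-AbsTopIII-Cor-29.md`, statements
`ArchimedeanReconstructionCor29Sub.lean`).  In an additive holomorphic chart at an NF-point `x` every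
clause of Cor 2.9 is a statement about the complex plane: the local additive structure at `x` is
`a +ₓ b = a + b − x` with division maps `(1/n)·ₓ v = x + (v − x)/n` (Prop 2.5 (e)), an NF-rational
function vanishing at `x` is a function `f : ℂ → ℂ` with `f x = 0` differentiable at `x`, its
differential `df|_x` is `deriv f x` (the cotangent line `ω_x = ℂ · dz`), and the germ group `𝒜_x` is
`germAut x` of `HolomorphicCoresLocalLinearProofs.lean` (= the germs `z ↦ x + c (z − x)`, `c ∈ ℂ^×`,
by the rigidity theorem `mem_germAut_iff`), acting on points by its canonical affine representatives.
For this model we PROVE the rows of the sub-DAG (statements of `…Cor29Sub.lean`):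

* M0 `isLocalAddDatumAt_ball` — row a.r1 (`IsLocalAddDatumAt` on every ball around `x`);
* M1 `tendsto_nat_mul_apply_scale` — row a.r2: `n · f(x + (v − x)/n) → f′(x) · (v − x)`
  (Taylor at a simple point; from `HasDerivAt.tendsto_slope_zero`); `iotaComputesLimits` — rows
  a.r3/a.r4 with `ι v = (v − x) · id`; `differentialsSpan` — row 0.r5 (`dz` spans);
* M4 `iotaIsEmbedding`, M5 `iotaAdditive` — rows a.r5/a.r6;
* M6/M7 `actionScalar`, `scalarFieldIso` — rows b.r1/b.r2: the scalar of `u ∈ 𝒜_x` pinned by `ι` is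
  its multiplier, i.e. the field isomorphism `𝒜_x ∪ {0} ⥲ k_v` of Cor 2.9 (b) is
  `(germAutIsoUnits x).symm` (inverse of the tautological action of Prop 2.6 (a)), and it is additive
  for the action-defined sum; M9 `scalarCompatibleWithTrans` — row b.r4 (translation conjugation
  `germAutTrans` does not change the multiplier); `act_germ` — the action used IS by representatives
  of the germs.

Honest scope: this is the chart-level content only («immediate from the constructions»); the
identification of `X^top = X_v(k_v)` near an NF-point with an open of `ℂ ≅ k_v` by a chart `f_U` in
which the transported local additive structure of Cor 2.7 (c) is affine-conjugate to `+` (it comes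
from the group law of `E`, holomorphic in the uniformising coordinate) is the junction with Cor 2.8 /
Cor 2.7 and is NOT constructed here (interface `NFCurveData`, TODO-merge L4-t1).  Refereed pre-IUT
material; nothing here bears on the disputed [IUTchIII] Cor 3.12; typed ≠ endorsed.
-/

noncomputable section

namespace Literature.AnabelianGeometry.AbsoluteAnabelian

open _root_.Filter _root_.Topology
open scoped _root_.Topology

namespace ArchimedeanReconstruction.Cor29Model

open Cor29

/-! ### The model data -/

/-- The local additive structure of `ℂ` at `x`: `a +ₓ b := a + b − x` (Prop 2.5 (e) for `U ⊆ ℂ`).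
[cite: MochizukiAbsTopIII2015, Proposition 2.5 (e) p.57] -/
def ladd (x a b : ℂ) : ℂ := a + b - x

/-- The division maps of the local additive structure at `x`: `(1/n)·ₓ v := x + (v − x)/n`
(junk `x` at `n = 0`). [cite: MochizukiAbsTopIII2015, Corollary 2.9 (a) p.65] -/
def scale (x : ℂ) (n : ℕ) (v : ℂ) : ℂ := x + (v - x) / n

/-- The functional `ι_{U_X,x}(v) ∈ Hom_ℂ(ω_x, ℂ)` of Cor 2.9 (a) in the chart, with `ω_x = ℂ · dz`
identified with `ℂ`: `ι(v)(ω) = (v − x) · ω`. [cite: MochizukiAbsTopIII2015, Corollary 2.9 (a) p.65] -/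
def iota (x v : ℂ) : ℂ →ₗ[ℂ] ℂ := (v - x) • LinearMap.id

/-- The MULTIPLIER of a germ automorphism: the inverse `𝒜_x ⥲ ℂ^×` of the tautological action
`germAutIsoUnits x : ℂ^× ⥲ 𝒜_x` of Prop 2.6 (a).  This is the map that Cor 2.9 (b) characterises.
[cite: MochizukiAbsTopIII2015, Corollary 2.9 (b) p.65] -/
def mult (x : ℂ) : germAut x ≃ₜ* ℂˣ := (germAutIsoUnits x).symm

/-- The action of `u ∈ 𝒜_x` on points near `x` by its canonical affine representative
`v ↦ x + c (v − x)`, `c` the multiplier of `u` (cf. `act_germ`: the germ of this map IS `u`).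
[cite: MochizukiAbsTopIII2015, Corollary 2.9 (b) p.65] -/
def act (x : ℂ) (u : germAut x) (v : ℂ) : ℂ := x + (mult x u : ℂ) * (v - x)

/-- The local linear holomorphic structure of Cor 2.7 (e) on the plane: `𝒜_p = germAut p`, the
tautological `ℂ^× ⥲ 𝒜_p`, translation conjugation `𝒜_p ⥲ 𝒜_{p'}` — the construction
`localLinearHolStructureOfGerms` of `HolomorphicCoresLocalLinearProofs.lean` with the plane itself as
index type. [cite: MochizukiAbsTopIII2015, Corollary 2.7 (e) p.60] -/
def planeStructure : LocalLinearHolStructure ℂ where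
  A p := germAut p
  isoUnits p := germAutIsoUnits p
  trans p p' := germAutTrans p p'
  trans_self p := germAutTrans_self p
  trans_comp p p' p'' := germAutTrans_comp p p' p''
  trans_isoUnits p p' := germAutIsoUnits_trans p p'

variable (x : ℂ)

/-- Unfolding `a +ₓ b`. (Auxiliary.) [cite: MochizukiAbsTopIII2015, Proposition 2.5 (e) p.57] -/
@[simp] theorem ladd_apply (a b : ℂ) : ladd x a b = a + b - x := rfl

/-- Unfolding `(1/n)·ₓ v`. (Auxiliary.) [cite: MochizukiAbsTopIII2015, Corollary 2.9 (a) p.65] -/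
@[simp] theorem scale_apply (n : ℕ) (v : ℂ) : scale x n v = x + (v - x) / n := rfl

/-- Unfolding `ι(v)(ω) = (v − x) · ω`. (Auxiliary.) [cite: MochizukiAbsTopIII2015, Corollary 2.9 (a) p.65] -/
@[simp] theorem iota_apply (v ω : ℂ) : iota x v ω = (v - x) * ω := by
  simp [iota]

/-- `ι(x) = 0` (the origin goes to the zero functional).
[cite: MochizukiAbsTopIII2015, Corollary 2.9 (a) p.65] -/
@[simp] theorem iota_self : iota x x = 0 := by
  simp [iota]

/-- Unfolding the action of `u ∈ 𝒜_x` on points. (Auxiliary.) [cite: MochizukiAbsTopIII2015, Corollary 2.9 (b) p.65] -/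
@[simp] theorem act_apply (u : germAut x) (v : ℂ) : act x u v = x + (mult x u : ℂ) * (v - x) := rfl

/-- `u = germAutIsoUnits x (mult x u)`. (Auxiliary.)
[cite: MochizukiAbsTopIII2015, Proposition 2.6 (a) p.57] -/
theorem germAutIsoUnits_mult (u : germAut x) : germAutIsoUnits x (mult x u) = u :=
  (germAutIsoUnits x).apply_symm_apply u

/-- **The action is by representatives**: the germ at `x` of `act x u` IS the germ `u ∈ 𝒜_x`
(`mulGerm x c` is by definition the germ of `z ↦ x + c (z − x)`).
[cite: MochizukiAbsTopIII2015, Corollary 2.9 (b) p.65] -/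
theorem act_germ (u : germAut x) :
    LocGerm.ofFun (act x u) (LocGerm.tendsto_mulAffine x (mult x u : ℂ)) =
      (((u : germAut x) : (LocGerm x)ˣ) : LocGerm x) := by
  conv_rhs => rw [← germAutIsoUnits_mult x u]
  rw [val_germAutIsoUnits]
  rfl

/-- The action of `u` tends to `x` at `x` (it is continuous and fixes `x`). (Auxiliary.)
[cite: MochizukiAbsTopIII2015, Corollary 2.9 (b) p.65] -/
theorem tendsto_act (u : germAut x) : Tendsto (act x u) (𝓝 x) (𝓝 x) :=
  LocGerm.tendsto_mulAffine x (mult x u : ℂ)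

/-! ### Row a.r1: the local additive datum on balls -/

/-- Iterating `p ↦ p + c` from `x`. (Private helper.) [folklore] -/
private theorem iterate_add_const (c : ℂ) (n : ℕ) : (fun p : ℂ => p + c)^[n] x = x + n * c := by
  induction n with
  | zero => simp
  | succ n ih => rw [Function.iterate_succ_apply', ih]; push_cast; ring

/-- **Row Cor-29.a.r1 at the model (M0)**: every ball around `x` carries the local additive structure
`a +ₓ b = a + b − x` with division maps `x + (v − x)/n` — all clauses of `IsLocalAddDatumAt`.
[cite: MochizukiAbsTopIII2015, Corollary 2.9 (a) pp.64–65] -/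
theorem isLocalAddDatumAt_ball {r : ℝ} (hr : 0 < r) :
    IsLocalAddDatumAt (ladd x) (scale x) x (Metric.ball x r) where
  isOpen := Metric.isOpen_ball
  mem := Metric.mem_ball_self hr
  origin_left b _ := by simp
  origin_right a _ := by simp
  continuousOn_ladd := by
    have : Continuous (Function.uncurry (ladd x)) := by
      unfold ladd Function.uncurry
      fun_prop
    exact this.continuousOn
  mapsTo_scale n hn v hv := by
    rw [Metric.mem_ball, dist_eq_norm] at hv ⊢
    have hn' : (0 : ℝ) < n := by exact_mod_cast hn
    have h1 : (1 : ℝ) ≤ n := by exact_mod_cast hn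
    rw [scale_apply, add_sub_cancel_left, norm_div, Complex.norm_natCast]
    calc ‖v - x‖ / n ≤ ‖v - x‖ / 1 := by gcongr
      _ < r := by simpa using hv
  continuousOn_scale n _ := by
    have : Continuous (scale x n) := by unfold scale; fun_prop
    exact this.continuousOn
  iterate_scale n hn v _ := by
    have hn' : (n : ℂ) ≠ 0 := by exact_mod_cast hn.ne'
    have hfun : ladd x (scale x n v) = fun p : ℂ => p + (v - x) / n := by
      funext p; simp [ladd, scale]; ring
    rw [hfun, iterate_add_const, mul_div_cancel₀ _ hn']
    ring

/-! ### Rows a.r2–a.r4: the limit formula -/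

/-- **Row Cor-29.a.r2 at the model (M1), the Taylor limit**: if `f` has derivative `c` at `x` and
`f x = 0`, then `n · f(x + (v − x)/n) → c · (v − x)` — for EVERY `v ∈ ℂ`.
[cite: MochizukiAbsTopIII2015, Corollary 2.9 (a) p.65] -/
theorem tendsto_nat_mul_apply_scale {f : ℂ → ℂ} {c : ℂ} (hf : HasDerivAt f c x) (hfx : f x = 0)
    (v : ℂ) : Tendsto (fun n : ℕ => (n : ℂ) * f (scale x n v)) atTop (𝓝 (c * (v - x))) := by
  rcases eq_or_ne v x with rfl | hv
  · simp [scale, hfx]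
  · have hvx : v - x ≠ 0 := sub_ne_zero.2 hv
    -- `t_n := (v - x)/n → 0`, within `{0}ᶜ` eventually
    have ht0 : Tendsto (fun n : ℕ => (v - x) / (n : ℂ)) atTop (𝓝 0) :=
      tendsto_const_div_atTop_nhds_zero_nat (v - x)
    have htne : ∀ᶠ n : ℕ in atTop, (v - x) / (n : ℂ) ∈ ({0}ᶜ : Set ℂ) := by
      filter_upwards [eventually_ne_atTop 0] with n hn
      have : (n : ℂ) ≠ 0 := by exact_mod_cast hn
      simp [hvx, this]
    have ht : Tendsto (fun n : ℕ => (v - x) / (n : ℂ)) atTop (𝓝[≠] 0) :=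
      tendsto_nhdsWithin_iff.2 ⟨ht0, htne⟩
    have hslope := (hf.tendsto_slope_zero.comp ht).const_mul (v - x)
    rw [mul_comm c]
    refine hslope.congr' ?_
    filter_upwards [eventually_ne_atTop 0] with n hn
    have hn' : (n : ℂ) ≠ 0 := by exact_mod_cast hn
    simp only [Function.comp_apply, hfx, sub_zero, smul_eq_mul, scale_apply]
    field_simp

/-- **Rows Cor-29.a.r3/a.r4 at the model (M2/M3)**: with `ω_x = ℂ · dz ≅ ℂ`, `df|_x = deriv f x`,
the functional `ι(v) = (v − x) · id` COMPUTES the limits of row a.r2 for every function vanishing at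
`x` and differentiable there — on ANY set `U` (`IotaComputesLimits`).  In particular the limit depends
only on `deriv f x` (`Cor29.limit_eq_of_d_eq`) and exists (`Cor29.limitExists_of_iotaComputesLimits`).
[cite: MochizukiAbsTopIII2015, Corollary 2.9 (a) p.65] -/
theorem iotaComputesLimits (U : Set ℂ) :
    IotaComputesLimits (fun (f : ℂ → ℂ) v => f v) (fun f => f x = 0 ∧ DifferentiableAt ℂ f x)
      (fun f => deriv f x) (scale x) U (iota x) := by
  intro v _ f hf
  rw [iota_apply, mul_comm]
  exact tendsto_nat_mul_apply_scale x hf.2.hasDerivAt hf.1 v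

/-- **Row Cor-29.0.r5 at the model**: the differentials of functions vanishing at `x` span
`ω_x ≅ ℂ`: `ω = ω · d(z − x)|_x`. [cite: MochizukiAbsTopIII2015, Corollary 2.9 (a) p.65] -/
theorem differentialsSpan :
    DifferentialsSpan (𝕜 := ℂ) (fun f : ℂ → ℂ => f x = 0 ∧ DifferentiableAt ℂ f x)
      (fun f => deriv f x) := by
  intro ω
  refine ⟨fun z => z - x, ω, ⟨sub_self x, ?_⟩, ?_⟩
  · fun_prop
  · have : deriv (fun z : ℂ => z - x) x = 1 := by
      rw [deriv_sub_const, deriv_id'']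
    simp [this]

/-! ### Rows a.r5/a.r6: embedding and additivity -/

/-- **Row Cor-29.a.r5 at the model (M4)**: `v ↦ ι(v)` is a topological embedding of any `U ⊆ ℂ` into
`Hom_ℂ(ω_x, ℂ) ⊆ (ω_x → ℂ)` (pointwise topology): composing with evaluation at `dz` (i.e. at `1`)
gives the translation `v ↦ v − x`. [cite: MochizukiAbsTopIII2015, Corollary 2.9 (a) p.65] -/
theorem iotaIsEmbedding (U : Set ℂ) : IotaIsEmbedding U (iota x) := by
  unfold IotaIsEmbedding
  have hcont : Continuous (fun v : U => fun ω : ℂ => iota x (v : ℂ) ω) := by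
    refine continuous_pi fun ω => ?_
    simp only [iota_apply]
    fun_prop
  have hev : Continuous (fun g : ℂ → ℂ => g 1) := continuous_apply 1
  have hcomp : (fun g : ℂ → ℂ => g 1) ∘ (fun v : U => fun ω : ℂ => iota x (v : ℂ) ω) =
      (Homeomorph.subRight x) ∘ ((↑) : U → ℂ) := by
    funext v
    simp [iota_apply]
  have hemb : IsEmbedding ((fun g : ℂ → ℂ => g 1) ∘ fun v : U => fun ω : ℂ => iota x (v : ℂ) ω) := by
    rw [hcomp]
    exact (Homeomorph.subRight x).isEmbedding.comp IsEmbedding.subtypeVal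
  exact IsEmbedding.of_comp hcont hev hemb

/-- **Row Cor-29.a.r6 at the model (M5)**: `ι` is compatible with the local additive structures:
`ι(a +ₓ b) = ι(a) + ι(b)` and `n · ι((1/n)·ₓ v) = ι(v)`.
[cite: MochizukiAbsTopIII2015, Corollary 2.9 (a) p.65] -/
theorem iotaAdditive (U : Set ℂ) : IotaAdditive (𝕜 := ℂ) (ladd x) (scale x) U (iota x) := by
  refine ⟨fun a _ b _ _ => ?_, fun n hn v _ => ?_⟩
  · refine LinearMap.ext fun ω => ?_
    simp only [iota_apply, ladd_apply, LinearMap.add_apply]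
    ring
  · have hn' : (n : ℂ) ≠ 0 := by exact_mod_cast hn.ne'
    refine LinearMap.ext fun ω => ?_
    simp only [LinearMap.smul_apply, iota_apply, scale_apply, smul_eq_mul]
    field_simp
    ring

/-! ### Rows b.r1–b.r4: the scalar of a germ automorphism -/

/-- A property holding near `x` in `ℂ` holds at some point `v ≠ x`. (Private helper.) [folklore] -/
private theorem exists_ne_of_eventually {P : ℂ → Prop} (h : ∀ᶠ v in 𝓝 x, P v) : ∃ v, v ≠ x ∧ P v := by
  haveI : (𝓝[≠] x).NeBot := NormedField.nhdsNE_neBot x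
  have h' : ∀ᶠ v in 𝓝[≠] x, P v ∧ v ∈ ({x}ᶜ : Set ℂ) :=
    (h.filter_mono nhdsWithin_le_nhds).and self_mem_nhdsWithin
  obtain ⟨v, hvP, hv⟩ := h'.exists
  exact ⟨v, Set.mem_compl_singleton_iff.1 hv, hvP⟩

/-- In the model, `ι(u · v) = c · ι(v)` for ALL `v`, `c` the multiplier of `u`. (Auxiliary.)
[cite: MochizukiAbsTopIII2015, Corollary 2.9 (b) p.65] -/
theorem iota_act (u : germAut x) (v : ℂ) : iota x (act x u v) = ((mult x u : ℂˣ) : ℂ) • iota x v := by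
  refine LinearMap.ext fun ω => ?_
  simp only [iota_apply, act_apply, LinearMap.smul_apply, smul_eq_mul]
  ring

/-- A scalar pinned by `ι` near `x` IS the multiplier. (Auxiliary: uniqueness in rows b.r1/b.r2.)
[cite: MochizukiAbsTopIII2015, Corollary 2.9 (b) p.65] -/
theorem eq_mult_of_eventually (u : germAut x) {a : ℂˣ}
    (ha : ∀ᶠ v in 𝓝 x, iota x (act x u v) = (a : ℂ) • iota x v) : a = mult x u := by
  obtain ⟨v, hv, hva⟩ := exists_ne_of_eventually x ha
  rw [iota_act] at hva
  have h1 := LinearMap.congr_fun hva 1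
  simp only [LinearMap.smul_apply, iota_apply, mul_one, smul_eq_mul] at h1
  exact Units.ext (mul_right_cancel₀ (sub_ne_zero.2 hv) h1).symm

/-- **Row Cor-29.b.r1 at the model (M6)**: for each `u ∈ 𝒜_x` there is a UNIQUE scalar `a ∈ ℂ^×`
with `ι(u · v) = a · ι(v)` near `x`, namely the multiplier of `u` (`ActionScalar`).
[cite: MochizukiAbsTopIII2015, Corollary 2.9 (b) p.65] -/
theorem actionScalar : ActionScalar (𝕜 := ℂ) (act x) x (iota x) := by
  intro u
  refine ⟨mult x u, Eventually.of_forall fun v => iota_act x u v, fun a ha => ?_⟩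
  exact eq_mult_of_eventually x u ha

/-- **Row Cor-29.b.r2 at the model (M7)**: the isomorphism of topological fields `𝒜_x ∪ {0} ⥲ k_v`
pinned by `ι` is the multiplier `mult x = (germAutIsoUnits x).symm` — a topological group isomorphism
`𝒜_x ⥲ ℂ^×` satisfying both clauses of `ScalarFieldIso`: it is the scalar of the action, and it is
additive for the action-defined sum (`χ · v = φ · v +ₓ ψ · v` near `x` forces
`mult χ = mult φ + mult ψ`). [cite: MochizukiAbsTopIII2015, Corollary 2.9 (b) p.65] -/
theorem scalarFieldIso : ScalarFieldIso planeStructure x (act x) (ladd x) (iota x) (mult x) := by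
  refine ⟨fun u => Eventually.of_forall fun v => iota_act x u v, fun φ ψ χ h => ?_⟩
  obtain ⟨v, hv, hvχ⟩ := exists_ne_of_eventually x h
  simp only [act_apply, ladd_apply] at hvχ
  have hvx : v - x ≠ 0 := sub_ne_zero.2 hv
  have key : ((mult x χ : ℂˣ) : ℂ) * (v - x) = ((mult x φ : ℂˣ) + (mult x ψ : ℂˣ) : ℂ) * (v - x) := by
    rw [add_mul]
    linear_combination hvχ
  exact mul_right_cancel₀ hvx key

/-- **Row Cor-29.b.r3 at the model (M8)**: the pinned scalar does not depend on the neighbourhood —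
the identity `ι(u · v) = mult(u) · ι(v)` holds on every `U` (indeed on all of `ℂ`), so the scalar read
off on any neighbourhood is `mult x u`. [cite: MochizukiAbsTopIII2015, Corollary 2.9 (b) p.65] -/
theorem scalar_restrict (u : germAut x) (U : Set ℂ) (hU : U ∈ 𝓝 x) {a : ℂˣ}
    (ha : ∀ v ∈ U, iota x (act x u v) = (a : ℂ) • iota x v) : a = mult x u :=
  eq_mult_of_eventually x u (Filter.mem_of_superset hU fun v hv => ha v hv)

/-- **Row Cor-29.b.r4 at the model (M9)**: the multiplier isomorphisms at two points are compatible
with the translation-conjugation isomorphism `𝒜_{x₁} ⥲ 𝒜_{x₂}` of Prop 2.6 (b)/Cor 2.7 (e)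
(`ScalarCompatibleWithTrans` for `planeStructure`): translations have derivative `1`.
[cite: MochizukiAbsTopIII2015, Corollary 2.9 (b) p.65] -/
theorem scalarCompatibleWithTrans (x₁ x₂ : ℂ) :
    ScalarCompatibleWithTrans (𝕜 := ℂ) planeStructure x₁ x₂ (mult x₁) (mult x₂) := by
  unfold ScalarCompatibleWithTrans
  ext u
  change ((mult x₂) ((germAutTrans x₁ x₂) u) : ℂ) = (mult x₁ u : ℂ)
  simp [mult, germAutTrans]

/-- **All rows at once at the model**: at every point `x ∈ ℂ` and every radius `r > 0`, the data
`(ball x r, ι, mult x)` satisfy rows a.r1–a.r6, b.r1, b.r2 of the sub-DAG — the pointwise clause of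
`NFCurveData.Cor29Refined` in the chart. [cite: MochizukiAbsTopIII2015, Corollary 2.9 pp.64–65] -/
theorem rows_at {r : ℝ} (hr : 0 < r) :
    IsLocalAddDatumAt (ladd x) (scale x) x (Metric.ball x r) ∧
      IotaComputesLimits (fun (f : ℂ → ℂ) v => f v) (fun f => f x = 0 ∧ DifferentiableAt ℂ f x)
        (fun f => deriv f x) (scale x) (Metric.ball x r) (iota x) ∧
      IotaIsEmbedding (Metric.ball x r) (iota x) ∧
      IotaAdditive (𝕜 := ℂ) (ladd x) (scale x) (Metric.ball x r) (iota x) ∧ iota x x = 0 ∧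
      ScalarFieldIso planeStructure x (act x) (ladd x) (iota x) (mult x) :=
  ⟨isLocalAddDatumAt_ball x hr, iotaComputesLimits x _, iotaIsEmbedding x _, iotaAdditive x _,
    iota_self x, scalarFieldIso x⟩

end ArchimedeanReconstruction.Cor29Model

end Literature.AnabelianGeometry.AbsoluteAnabelian

end
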